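import Summits.CriticalPhenomena.Ising3DConformalLimit.Theorems.EnergyNotSigmaSquaredEnergyGapSoftBondClosed

/-!
# `EnergyGapSoft`: the bond-level floor on adjacent merging
(item stmt-CriticalPhenomena-4473, route `EnergyNotSigmaSquared`; sequel to
`EnergyNotSigmaSquaredEnergyGapSoftBondClosed`)

Notation as there: `G = criticalTwoPoint 3`, `e₂ = Pi.single 1 1`, `β_c = criticalBeta 3`,
`A_par(x) = 1 - P^{{0}∆{x},{e₂}∆{x+e₂}}_{β_c}[0 ↔ e₂]`, `A_cross(x) = 1 - P^{{0}∆{x+e₂},{e₂}∆{x}}_{β_c}[0 ↔ e₂]`;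
the item is `A_par, A_cross → 0` (`energyGapSoft_iff_adjacentMerging`).  From the exact closed-bond
probability (`parBondClosed_eq`, `crossBondClosed_eq`) and `tanh β_c ≤ G(e₂)` this file derives the
first unconditional LOWER bound on adjacent merging:

* `parAvoidance_le_bondClosed`, `crossAvoidance_le_bondClosed` — `A_par(x), A_cross(x) ≤ P[0e₂ ∉ ω]`
  with the explicit two-point expressions;
* `parAvoidance_le_inv_cosh_sq`, `crossAvoidance_le_inv_cosh_sq`, `tanh_sq_le_merging` —
  **`A_par(x), A_cross(x) ≤ 1/cosh²β_c` for every `x ∈ ℤ³`**: two independent critical sourced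
  currents with the adjacent sources `0, e₂` and adjacent far targets merge with probability at least
  `tanh²β_c > 0`, uniformly in the target and for both pairings (GKS II traps the ratios,
  `G(e₂) ≤ G(x∓e₂)/G(x) ≤ G(e₂)⁻¹`);
* `adjacentTruncation_le_inv_cosh_sq` — the improved `κ = 0` envelope
  `⟨σ₀σ_{e₂};σ_xσ_{x+e₂}⟩_{β_c} ≤ (G(x)² + G(x+e₂)G(x-e₂)) / cosh²β_c` for all `x`
  (the Lebowitz/Aizenman envelope `G² + G₊G₋` of `adjacentTruncation_le` shrunk by the floor);
* `parBondClosed_axis_tendsto`, `crossBondClosed_axis_tendsto`, `parAvoidance_axis_le`,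
  `crossAvoidance_axis_le` — on the `e₂` axis, where `G((n∓1)e₂)/G(ne₂) → 1` by reflection
  positivity (`criticalTwoPoint_axis_ratio_tendsto_one`), both closed-bond probabilities tend to
  `e^{-2β_c}`, so **`limsup A_par(n e₂), limsup A_cross(n e₂) ≤ e^{-2β_c}`**: the collinear critical
  sourced currents merge with probability `≥ 1 - e^{-2β_c} - o(1)`;
* `adjacentTruncation_axis_le` — **the axis envelope `limsup_n T(ne₂)/G(ne₂)² ≤ 2e^{-2β_c}`**
  (`T(ne₂) ≤ (2e^{-2β_c} + ε) G(ne₂)²` for large `n`; the item claims `o(G²)`, the unconditional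
  envelope is `(1 + G(e₂)⁻²)G²`).

Nothing here asserts the item: the bond floor is the scale-zero contribution to merging; the item
(`A_par → 0`, open) asks the contributions of all scales to exhaust the avoidance probability.

## References

* M. Aizenman, H. Duminil-Copin, V. Sidoravicius, Comm. Math. Phys. 334 (2015), §2.2
  eqs. (2.13)–(2.14) [AizenmanDuminilCopinSidoraviciusCMP2015].
* M. Aizenman, H. Duminil-Copin, Ann. of Math. 194 (2021), §3.2 eq. (3.11), Prop. 5.3, §5.5
  [AizenmanDuminilCopinAnnals2021].
* S. Friedli, Y. Velenik, *Statistical Mechanics of Lattice Systems* (CUP 2017), Thm. 3.20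
  [FriedliVelenik2017].
-/

noncomputable section

namespace Summit.CriticalPhenomena.Ising3DConformalLimit.EnergyNotSigmaSquaredEnergyGapSoft

open scoped symmDiff
open MeasureTheory Filter Topology Finset
open Literature.Probability.LatticeModels Literature.Probability.Percolation
open Summit.CriticalPhenomena.Ising3DConformalLimit.Theses.EnergyNotSigmaSquared
open Summit.CriticalPhenomena.Ising3DConformalLimit.PinnedClusterPoints (criticalTwoPoint_pos3)

/-- The single-current factor is trapped: for a ratio `r` with `G(e₂) ≤ r` and `r G(e₂) ≤ 1`,
`0 ≤ cosh β_c - sinh β_c r ≤ (cosh β_c)⁻¹` (`tanh β_c ≤ G(e₂)`). [folklore] -/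
theorem bondFactor_mem_Icc {r : ℝ} (hr₁ : criticalTwoPoint 3 (Pi.single 1 1) ≤ r)
    (hr₂ : r * criticalTwoPoint 3 (Pi.single 1 1) ≤ 1) :
    0 ≤ Real.cosh (criticalBeta 3) - Real.sinh (criticalBeta 3) * r ∧
      Real.cosh (criticalBeta 3) - Real.sinh (criticalBeta 3) * r ≤ (Real.cosh (criticalBeta 3))⁻¹ := by
  set β := criticalBeta 3 with hβdef
  set g := criticalTwoPoint 3 (Pi.single 1 1) with hg
  have hgpos : 0 < g := criticalTwoPoint_pos3 _
  have hcosh : 0 < Real.cosh β := Real.cosh_pos β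
  have hsinh : 0 ≤ Real.sinh β := Real.sinh_nonneg_iff.2 criticalBeta_three_pos.le
  have htanh := tanh_criticalBeta_le_criticalTwoPoint_e₂
  rw [Real.tanh_eq_sinh_div_cosh, div_le_iff₀ hcosh] at htanh
  have hsq : Real.cosh β ^ 2 - Real.sinh β ^ 2 = 1 := Real.cosh_sq_sub_sinh_sq β
  have hr0 : 0 ≤ r := hgpos.le.trans hr₁
  constructor
  · -- `sinh β r ≤ g cosh β r = cosh β (r g) ≤ cosh β`
    nlinarith [mul_le_mul_of_nonneg_right htanh hr0, mul_le_mul_of_nonneg_left hr₂ hcosh.le]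
  · -- `cosh β - sinh β r ≤ cosh β - sinh β g ≤ cosh β - sinh β tanh β = 1 / cosh β`
    have h1 : Real.sinh β * g ≤ Real.sinh β * r := mul_le_mul_of_nonneg_left hr₁ hsinh
    have h2 : (Real.cosh β - Real.sinh β * g) * Real.cosh β ≤ 1 := by
      nlinarith [mul_le_mul_of_nonneg_left htanh hsinh]
    rw [inv_eq_one_div, le_div_iff₀ hcosh]
    nlinarith [mul_le_mul_of_nonneg_right h1 hcosh.le]

/-! ### The bond-level floor on adjacent merging -/

/-- **`A_par(x) ≤ P[0e₂ ∉ ω] = (cosh β_c - sinh β_c G(x-e₂)/G(x)) (cosh β_c - sinh β_c G(x+e₂)/G(x))`**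
for every `x ∈ ℤ³`. [cite: AizenmanDuminilCopinSidoraviciusCMP2015, §2.2, eqs. (2.13)–(2.14)] -/
theorem parAvoidance_le_bondClosed (x : Site 3) :
    1 - (sourcedDoubleCurrentLawInf 3 (criticalBeta 3) ({0} ∆ {x})
          ({(Pi.single 1 1 : Site 3)} ∆ {x + Pi.single 1 1})).real (openConn 0 (Pi.single 1 1)) ≤
      (Real.cosh (criticalBeta 3) -
          Real.sinh (criticalBeta 3) * (criticalTwoPoint 3 (x - Pi.single 1 1) / criticalTwoPoint 3 x)) *
        (Real.cosh (criticalBeta 3) -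
          Real.sinh (criticalBeta 3) * (criticalTwoPoint 3 (x + Pi.single 1 1) / criticalTwoPoint 3 x)) := by
  rw [← parBondClosed_eq]
  exact one_sub_openConn_le_bondClosed criticalBeta_three_pos (even_card_singleton_symmDiff _ _)
    (even_card_singleton_symmDiff _ _) zdGraph_adj_zero_e₂.ne

/-- **`A_cross(x) ≤ P[0e₂ ∉ ω] = (cosh β_c - sinh β_c G(x)/G(x+e₂)) (cosh β_c - sinh β_c G(x)/G(x-e₂))`**
for every `x ∈ ℤ³`. [cite: AizenmanDuminilCopinSidoraviciusCMP2015, §2.2, eqs. (2.13)–(2.14)] -/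
theorem crossAvoidance_le_bondClosed (x : Site 3) :
    1 - (sourcedDoubleCurrentLawInf 3 (criticalBeta 3) ({0} ∆ {x + Pi.single 1 1})
          ({(Pi.single 1 1 : Site 3)} ∆ {x})).real (openConn 0 (Pi.single 1 1)) ≤
      (Real.cosh (criticalBeta 3) -
          Real.sinh (criticalBeta 3) * (criticalTwoPoint 3 x / criticalTwoPoint 3 (x + Pi.single 1 1))) *
        (Real.cosh (criticalBeta 3) -
          Real.sinh (criticalBeta 3) * (criticalTwoPoint 3 x / criticalTwoPoint 3 (x - Pi.single 1 1))) := by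
  rw [← crossBondClosed_eq]
  exact one_sub_openConn_le_bondClosed criticalBeta_three_pos (even_card_singleton_symmDiff _ _)
    (even_card_singleton_symmDiff _ _) zdGraph_adj_zero_e₂.ne

/-- The two ratios of the parallel factors are trapped by GKS II:
`G(e₂) ≤ G(x∓e₂)/G(x)` and `(G(x∓e₂)/G(x)) G(e₂) ≤ 1`. [cite: FriedliVelenik2017, Thm. 3.20, eq. (3.22), p. 109] -/
theorem parRatios_trapped (x : Site 3) :
    (criticalTwoPoint 3 (Pi.single 1 1) ≤ criticalTwoPoint 3 (x - Pi.single 1 1) / criticalTwoPoint 3 x ∧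
        criticalTwoPoint 3 (x - Pi.single 1 1) / criticalTwoPoint 3 x * criticalTwoPoint 3 (Pi.single 1 1) ≤ 1) ∧
      (criticalTwoPoint 3 (Pi.single 1 1) ≤ criticalTwoPoint 3 (x + Pi.single 1 1) / criticalTwoPoint 3 x ∧
        criticalTwoPoint 3 (x + Pi.single 1 1) / criticalTwoPoint 3 x * criticalTwoPoint 3 (Pi.single 1 1) ≤ 1) := by
  have hG : 0 < criticalTwoPoint 3 x := criticalTwoPoint_pos3 x
  refine ⟨⟨?_, ?_⟩, ?_, ?_⟩
  · rw [le_div_iff₀ hG, mul_comm]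
    exact criticalTwoPoint_mul_e₂_le_sub x
  · rw [div_mul_eq_mul_div, div_le_one hG]
    exact criticalTwoPoint_sub_mul_e₂_le x
  · rw [le_div_iff₀ hG, mul_comm]
    exact criticalTwoPoint_mul_e₂_le_add x
  · rw [div_mul_eq_mul_div, div_le_one hG]
    exact criticalTwoPoint_add_mul_e₂_le x

/-- The two ratios of the crossed factors are trapped by GKS II:
`G(e₂) ≤ G(x)/G(x±e₂)` and `(G(x)/G(x±e₂)) G(e₂) ≤ 1`. [cite: FriedliVelenik2017, Thm. 3.20, eq. (3.22), p. 109] -/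
theorem crossRatios_trapped (x : Site 3) :
    (criticalTwoPoint 3 (Pi.single 1 1) ≤ criticalTwoPoint 3 x / criticalTwoPoint 3 (x + Pi.single 1 1) ∧
        criticalTwoPoint 3 x / criticalTwoPoint 3 (x + Pi.single 1 1) * criticalTwoPoint 3 (Pi.single 1 1) ≤ 1) ∧
      (criticalTwoPoint 3 (Pi.single 1 1) ≤ criticalTwoPoint 3 x / criticalTwoPoint 3 (x - Pi.single 1 1) ∧
        criticalTwoPoint 3 x / criticalTwoPoint 3 (x - Pi.single 1 1) * criticalTwoPoint 3 (Pi.single 1 1) ≤ 1) := by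
  have hG1 : 0 < criticalTwoPoint 3 (x + Pi.single 1 1) := criticalTwoPoint_pos3 _
  have hG2 : 0 < criticalTwoPoint 3 (x - Pi.single 1 1) := criticalTwoPoint_pos3 _
  refine ⟨⟨?_, ?_⟩, ?_, ?_⟩
  · rw [le_div_iff₀ hG1, mul_comm]
    exact criticalTwoPoint_add_mul_e₂_le x
  · rw [div_mul_eq_mul_div, div_le_one hG1]
    exact criticalTwoPoint_mul_e₂_le_add x
  · rw [le_div_iff₀ hG2, mul_comm]
    exact criticalTwoPoint_sub_mul_e₂_le x
  · rw [div_mul_eq_mul_div, div_le_one hG2]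
    exact criticalTwoPoint_mul_e₂_le_sub x

/-- **Uniform merging floor, parallel pairing: `A_par(x) ≤ 1/cosh²β_c` for every `x ∈ ℤ³`** — two
independent critical sourced currents `0 → x`, `e₂ → x + e₂` merge with probability at least
`tanh²β_c > 0`, uniformly in the target. [cite: AizenmanDuminilCopinSidoraviciusCMP2015, §2.2, eqs. (2.13)–(2.14)] -/
theorem parAvoidance_le_inv_cosh_sq (x : Site 3) :
    1 - (sourcedDoubleCurrentLawInf 3 (criticalBeta 3) ({0} ∆ {x})
          ({(Pi.single 1 1 : Site 3)} ∆ {x + Pi.single 1 1})).real (openConn 0 (Pi.single 1 1)) ≤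
      (Real.cosh (criticalBeta 3))⁻¹ ^ 2 := by
  obtain ⟨⟨h₁, h₂⟩, h₃, h₄⟩ := parRatios_trapped x
  obtain ⟨a0, a1⟩ := bondFactor_mem_Icc h₁ h₂
  obtain ⟨b0, b1⟩ := bondFactor_mem_Icc h₃ h₄
  refine (parAvoidance_le_bondClosed x).trans ?_
  rw [sq]
  exact mul_le_mul a1 b1 b0 (inv_nonneg.2 (Real.cosh_pos _).le)

/-- **Uniform merging floor, crossed pairing: `A_cross(x) ≤ 1/cosh²β_c` for every `x ∈ ℤ³`.**
[cite: AizenmanDuminilCopinSidoraviciusCMP2015, §2.2, eqs. (2.13)–(2.14)] -/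
theorem crossAvoidance_le_inv_cosh_sq (x : Site 3) :
    1 - (sourcedDoubleCurrentLawInf 3 (criticalBeta 3) ({0} ∆ {x + Pi.single 1 1})
          ({(Pi.single 1 1 : Site 3)} ∆ {x})).real (openConn 0 (Pi.single 1 1)) ≤
      (Real.cosh (criticalBeta 3))⁻¹ ^ 2 := by
  obtain ⟨⟨h₁, h₂⟩, h₃, h₄⟩ := crossRatios_trapped x
  obtain ⟨a0, a1⟩ := bondFactor_mem_Icc h₁ h₂
  obtain ⟨b0, b1⟩ := bondFactor_mem_Icc h₃ h₄
  refine (crossAvoidance_le_bondClosed x).trans ?_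
  rw [sq]
  exact mul_le_mul a1 b1 b0 (inv_nonneg.2 (Real.cosh_pos _).le)

/-- `1 - 1/cosh²β = tanh²β`. [folklore] -/
theorem one_sub_inv_cosh_sq (b : ℝ) : 1 - (Real.cosh b)⁻¹ ^ 2 = Real.tanh b ^ 2 := by
  have hcosh : Real.cosh b ≠ 0 := (Real.cosh_pos b).ne'
  have hsq : Real.cosh b ^ 2 - Real.sinh b ^ 2 = 1 := Real.cosh_sq_sub_sinh_sq b
  rw [Real.tanh_eq_sinh_div_cosh, div_pow, inv_pow, eq_div_iff (pow_ne_zero 2 hcosh), sub_mul,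
    inv_mul_cancel₀ (pow_ne_zero 2 hcosh)]
  linarith

/-- **The merging probabilities are at least `tanh²β_c > 0`, uniformly**:
`tanh²β_c ≤ P_par(x)` and `tanh²β_c ≤ P_cross(x)` for every `x ∈ ℤ³`, with `0 < tanh²β_c`
(`β_c(3) > 0`). [cite: AizenmanDuminilCopinSidoraviciusCMP2015, §2.2, eqs. (2.13)–(2.14)] -/
theorem tanh_sq_le_merging (x : Site 3) :
    0 < Real.tanh (criticalBeta 3) ^ 2 ∧
      Real.tanh (criticalBeta 3) ^ 2 ≤ (sourcedDoubleCurrentLawInf 3 (criticalBeta 3) ({0} ∆ {x})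
          ({(Pi.single 1 1 : Site 3)} ∆ {x + Pi.single 1 1})).real (openConn 0 (Pi.single 1 1)) ∧
      Real.tanh (criticalBeta 3) ^ 2 ≤ (sourcedDoubleCurrentLawInf 3 (criticalBeta 3) ({0} ∆ {x + Pi.single 1 1})
          ({(Pi.single 1 1 : Site 3)} ∆ {x})).real (openConn 0 (Pi.single 1 1)) := by
  have h1 := parAvoidance_le_inv_cosh_sq x
  have h2 := crossAvoidance_le_inv_cosh_sq x
  rw [← one_sub_inv_cosh_sq]
  refine ⟨?_, by linarith, by linarith⟩
  rw [one_sub_inv_cosh_sq]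
  have htanh : 0 < Real.tanh (criticalBeta 3) := by
    rw [Real.tanh_eq_sinh_div_cosh]
    exact div_pos (Real.sinh_pos_iff.2 criticalBeta_three_pos) (Real.cosh_pos _)
  positivity

/-- **The improved `κ = 0` envelope**: for every `x ∈ ℤ³`,
`⟨σ₀σ_{e₂} ; σ_xσ_{x+e₂}⟩_{β_c} ≤ (G(x)² + G(x+e₂)G(x-e₂)) / cosh²β_c` (the Lebowitz/Aizenman envelope
`G² + G₊G₋` shrunk by the bond-level merging floor). [cite: AizenmanDuminilCopinAnnals2021, eq. (3.11)] -/
theorem adjacentTruncation_le_inv_cosh_sq (x : Site 3) :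
    criticalCorr 3 4 ![0, (Pi.single 1 1 : Site 3), x, x + Pi.single 1 1] -
        criticalCorr 3 2 ![0, (Pi.single 1 1 : Site 3)] * criticalCorr 3 2 ![x, x + Pi.single 1 1] ≤
      (criticalTwoPoint 3 x ^ 2 + criticalTwoPoint 3 (x + Pi.single 1 1) * criticalTwoPoint 3 (x - Pi.single 1 1)) *
        (Real.cosh (criticalBeta 3))⁻¹ ^ 2 := by
  rw [adjacentTruncation_eq, add_mul]
  have hG2 : 0 ≤ criticalTwoPoint 3 x ^ 2 := sq_nonneg _
  have hP : 0 ≤ criticalTwoPoint 3 (x + Pi.single 1 1) * criticalTwoPoint 3 (x - Pi.single 1 1) :=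
    mul_nonneg (criticalTwoPoint_nonneg' _) (criticalTwoPoint_nonneg' _)
  exact add_le_add (mul_le_mul_of_nonneg_left (parAvoidance_le_inv_cosh_sq x) hG2)
    (mul_le_mul_of_nonneg_left (crossAvoidance_le_inv_cosh_sq x) hP)

/-! ### On the axis the floor is `1 - e^{-2β_c}` asymptotically -/

/-- Axis bookkeeping: `(k+1)e₂ + e₂ = (k+2)e₂`. [folklore] -/
theorem axis_single_succ_add (k : ℕ) :
    (Pi.single 1 ((k + 1 : ℕ) : ℤ) : Site 3) + Pi.single 1 1 = Pi.single 1 ((k + 2 : ℕ) : ℤ) := by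
  rw [← Pi.single_add]; push_cast; ring_nf

/-- Axis bookkeeping: `(k+1)e₂ - e₂ = k e₂`. [folklore] -/
theorem axis_single_succ_sub (k : ℕ) :
    (Pi.single 1 ((k + 1 : ℕ) : ℤ) : Site 3) - Pi.single 1 1 = Pi.single 1 ((k : ℕ) : ℤ) := by
  rw [← Pi.single_sub]; push_cast; ring_nf

/-- `(cosh β - sinh β)² = e^{-2β}`. [folklore] -/
theorem cosh_sub_sinh_mul_self (b : ℝ) :
    (Real.cosh b - Real.sinh b * 1) * (Real.cosh b - Real.sinh b * 1) = Real.exp (-2 * b) := by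
  rw [mul_one, Real.cosh_sub_sinh, ← Real.exp_add]
  ring_nf

/-- The backward axis ratio tends to one: `G(k e₂)/G((k+1)e₂) → 1` (inverse of
`criticalTwoPoint_axis_ratio_tendsto_one'`). [cite: AizenmanDuminilCopinAnnals2021, arXiv:1912.07973 Prop. 5.3 (5.17) and §5.5 proof of Prop. 5.9 (p. 19)] -/
theorem axis_ratio_inv_tendsto_one :
    Tendsto (fun k : ℕ => criticalTwoPoint 3 (Pi.single 1 (k : ℤ)) /
      criticalTwoPoint 3 (Pi.single 1 ((k + 1 : ℕ) : ℤ))) atTop (𝓝 1) := by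
  have h := (criticalTwoPoint_axis_ratio_tendsto_one' (1 : Fin 3)).inv₀ one_ne_zero
  rw [inv_one] at h
  refine h.congr fun k => ?_
  rw [inv_div]

/-- The backward shifted axis ratio tends to one: `G((k+1)e₂)/G((k+2)e₂) → 1`. [cite: AizenmanDuminilCopinAnnals2021, arXiv:1912.07973 Prop. 5.3 (5.17) and §5.5 proof of Prop. 5.9 (p. 19)] -/
theorem axis_ratio_inv_tendsto_one' :
    Tendsto (fun k : ℕ => criticalTwoPoint 3 (Pi.single 1 ((k + 1 : ℕ) : ℤ)) /
      criticalTwoPoint 3 (Pi.single 1 ((k + 2 : ℕ) : ℤ))) atTop (𝓝 1) := by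
  have h := (criticalTwoPoint_axis_ratio_tendsto_one (1 : Fin 3)).inv₀ one_ne_zero
  rw [inv_one] at h
  refine h.congr fun k => ?_
  rw [inv_div]

/-- **Along the `e₂` axis the parallel closed-bond probability tends to `e^{-2β_c}`**: at
`x = (k+1)e₂` both factors `cosh β_c - sinh β_c G(x∓e₂)/G(x)` tend to `cosh β_c - sinh β_c = e^{-β_c}`
by axis ratio regularity (reflection positivity). [cite: AizenmanDuminilCopinAnnals2021, arXiv:1912.07973 Prop. 5.3 (5.17) and §5.5 proof of Prop. 5.9 (p. 19)] -/
theorem parBondClosed_axis_tendsto :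
    Tendsto (fun k : ℕ =>
      (Real.cosh (criticalBeta 3) - Real.sinh (criticalBeta 3) *
          (criticalTwoPoint 3 (Pi.single 1 (k : ℤ)) / criticalTwoPoint 3 (Pi.single 1 ((k + 1 : ℕ) : ℤ)))) *
        (Real.cosh (criticalBeta 3) - Real.sinh (criticalBeta 3) *
          (criticalTwoPoint 3 (Pi.single 1 ((k + 2 : ℕ) : ℤ)) / criticalTwoPoint 3 (Pi.single 1 ((k + 1 : ℕ) : ℤ)))))
      atTop (𝓝 (Real.exp (-2 * criticalBeta 3))) := by
  rw [← cosh_sub_sinh_mul_self]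
  exact (tendsto_const_nhds.sub (tendsto_const_nhds.mul axis_ratio_inv_tendsto_one)).mul
    (tendsto_const_nhds.sub (tendsto_const_nhds.mul (criticalTwoPoint_axis_ratio_tendsto_one 1)))

/-- **Along the `e₂` axis the crossed closed-bond probability tends to `e^{-2β_c}`** likewise.
[cite: AizenmanDuminilCopinAnnals2021, arXiv:1912.07973 Prop. 5.3 (5.17) and §5.5 proof of Prop. 5.9 (p. 19)] -/
theorem crossBondClosed_axis_tendsto :
    Tendsto (fun k : ℕ =>
      (Real.cosh (criticalBeta 3) - Real.sinh (criticalBeta 3) *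
          (criticalTwoPoint 3 (Pi.single 1 ((k + 1 : ℕ) : ℤ)) / criticalTwoPoint 3 (Pi.single 1 ((k + 2 : ℕ) : ℤ)))) *
        (Real.cosh (criticalBeta 3) - Real.sinh (criticalBeta 3) *
          (criticalTwoPoint 3 (Pi.single 1 ((k + 1 : ℕ) : ℤ)) / criticalTwoPoint 3 (Pi.single 1 (k : ℤ)))))
      atTop (𝓝 (Real.exp (-2 * criticalBeta 3))) := by
  rw [← cosh_sub_sinh_mul_self]
  exact (tendsto_const_nhds.sub (tendsto_const_nhds.mul axis_ratio_inv_tendsto_one')).mul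
    (tendsto_const_nhds.sub (tendsto_const_nhds.mul (criticalTwoPoint_axis_ratio_tendsto_one' 1)))

/-- **Along the `e₂` axis, `limsup A_par(n e₂) ≤ e^{-2β_c}`**: the two collinear critical sourced
currents `0 → n e₂`, `e₂ → (n+1)e₂` merge with probability at least `1 - e^{-2β_c} - o(1)`.
[cite: AizenmanDuminilCopinAnnals2021, arXiv:1912.07973 Prop. 5.3 (5.17) and §5.5 proof of Prop. 5.9 (p. 19)] -/
theorem parAvoidance_axis_le (ε : ℝ) (hε : 0 < ε) :
    ∃ N : ℕ, ∀ n : ℕ, N ≤ n →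
      1 - (sourcedDoubleCurrentLawInf 3 (criticalBeta 3) ({0} ∆ {(Pi.single 1 (n : ℤ) : Site 3)})
            ({(Pi.single 1 1 : Site 3)} ∆ {Pi.single 1 (n : ℤ) + Pi.single 1 1})).real
          (openConn 0 (Pi.single 1 1)) ≤ Real.exp (-2 * criticalBeta 3) + ε := by
  obtain ⟨K, hK⟩ := eventually_atTop.1
    ((tendsto_order.1 parBondClosed_axis_tendsto).2 (Real.exp (-2 * criticalBeta 3) + ε) (by linarith))
  refine ⟨K + 1, fun n hn => ?_⟩
  obtain ⟨k, rfl⟩ : ∃ k, n = k + 1 := ⟨n - 1, by omega⟩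
  have hbound := parAvoidance_le_bondClosed (Pi.single 1 ((k + 1 : ℕ) : ℤ))
  rw [axis_single_succ_add, axis_single_succ_sub] at hbound
  rw [axis_single_succ_add]
  exact hbound.trans (hK k (by omega)).le

/-- **Along the `e₂` axis, `limsup A_cross(n e₂) ≤ e^{-2β_c}`** (crossed pairing: `0 → (n+1)e₂`,
`e₂ → n e₂`). [cite: AizenmanDuminilCopinAnnals2021, arXiv:1912.07973 Prop. 5.3 (5.17) and §5.5 proof of Prop. 5.9 (p. 19)] -/
theorem crossAvoidance_axis_le (ε : ℝ) (hε : 0 < ε) :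
    ∃ N : ℕ, ∀ n : ℕ, N ≤ n →
      1 - (sourcedDoubleCurrentLawInf 3 (criticalBeta 3) ({0} ∆ {(Pi.single 1 (n : ℤ) : Site 3) + Pi.single 1 1})
            ({(Pi.single 1 1 : Site 3)} ∆ {Pi.single 1 (n : ℤ)})).real
          (openConn 0 (Pi.single 1 1)) ≤ Real.exp (-2 * criticalBeta 3) + ε := by
  obtain ⟨K, hK⟩ := eventually_atTop.1
    ((tendsto_order.1 crossBondClosed_axis_tendsto).2 (Real.exp (-2 * criticalBeta 3) + ε) (by linarith))
  refine ⟨K + 1, fun n hn => ?_⟩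
  obtain ⟨k, rfl⟩ : ∃ k, n = k + 1 := ⟨n - 1, by omega⟩
  have hbound := crossAvoidance_le_bondClosed (Pi.single 1 ((k + 1 : ℕ) : ℤ))
  rw [axis_single_succ_add, axis_single_succ_sub] at hbound
  rw [axis_single_succ_add]
  exact hbound.trans (hK k (by omega)).le

/-- **The axis envelope**: `limsup_n ⟨σ₀σ_{e₂} ; σ_{ne₂}σ_{(n+1)e₂}⟩_{β_c} / ⟨σ₀σ_{ne₂}⟩²_{β_c} ≤ 2e^{-2β_c}`,
i.e. for every `ε > 0` and all large `n`, `T(ne₂) ≤ (2e^{-2β_c} + ε) G(ne₂)²` — against the item's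
`o(G²)` and the unconditional `(1 + G(e₂)⁻²) G²` of `adjacentTruncation_le` (on the axis
`G((n+1)e₂)G((n-1)e₂)/G(ne₂)² → 1`, `secondRatio_axis_tendsto_one`). [cite: AizenmanDuminilCopinAnnals2021, eq. (3.11)] -/
theorem adjacentTruncation_axis_le (ε : ℝ) (hε : 0 < ε) :
    ∃ N : ℕ, ∀ n : ℕ, N ≤ n →
      criticalCorr 3 4 ![0, (Pi.single 1 1 : Site 3), Pi.single 1 (n : ℤ), Pi.single 1 (n : ℤ) + Pi.single 1 1] -
          criticalCorr 3 2 ![0, (Pi.single 1 1 : Site 3)] *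
            criticalCorr 3 2 ![(Pi.single 1 (n : ℤ) : Site 3), Pi.single 1 (n : ℤ) + Pi.single 1 1] ≤
        (2 * Real.exp (-2 * criticalBeta 3) + ε) * criticalTwoPoint 3 (Pi.single 1 (n : ℤ)) ^ 2 := by
  -- the bound `pc_k + s_k cc_k → e^{-2β} + 1 · e^{-2β}`
  have hB := parBondClosed_axis_tendsto.add (secondRatio_axis_tendsto_one.mul crossBondClosed_axis_tendsto)
  rw [one_mul, ← two_mul] at hB
  obtain ⟨K, hK⟩ := eventually_atTop.1
    ((tendsto_order.1 hB).2 (2 * Real.exp (-2 * criticalBeta 3) + ε) (by linarith))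
  refine ⟨K + 1, fun n hn => ?_⟩
  obtain ⟨k, rfl⟩ : ∃ k, n = k + 1 := ⟨n - 1, by omega⟩
  have hk := (hK k (by omega)).le
  set x : Site 3 := Pi.single 1 ((k + 1 : ℕ) : ℤ) with hx
  have hpar := parAvoidance_le_bondClosed x
  have hcross := crossAvoidance_le_bondClosed x
  rw [adjacentTruncation_eq]
  rw [hx, axis_single_succ_add, axis_single_succ_sub] at hpar hcross ⊢
  set G0 := criticalTwoPoint 3 (Pi.single 1 ((k : ℕ) : ℤ)) with hG0
  set G1 := criticalTwoPoint 3 (Pi.single 1 ((k + 1 : ℕ) : ℤ)) with hG1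
  set G2 := criticalTwoPoint 3 (Pi.single 1 ((k + 2 : ℕ) : ℤ)) with hG2
  have hG1pos : 0 < G1 := criticalTwoPoint_pos3 _
  have hG1sq : 0 < G1 ^ 2 := pow_pos hG1pos 2
  have hP : 0 ≤ G2 * G0 := mul_nonneg (criticalTwoPoint_nonneg' _) (criticalTwoPoint_nonneg' _)
  set Ap := 1 - (sourcedDoubleCurrentLawInf 3 (criticalBeta 3) ({0} ∆ {Pi.single 1 ((k + 1 : ℕ) : ℤ)})
    ({(Pi.single 1 1 : Site 3)} ∆ {Pi.single 1 ((k + 2 : ℕ) : ℤ)})).real (openConn 0 (Pi.single 1 1)) with hAp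
  set Ac := 1 - (sourcedDoubleCurrentLawInf 3 (criticalBeta 3) ({0} ∆ {Pi.single 1 ((k + 2 : ℕ) : ℤ)})
    ({(Pi.single 1 1 : Site 3)} ∆ {Pi.single 1 ((k + 1 : ℕ) : ℤ)})).real (openConn 0 (Pi.single 1 1)) with hAc
  set pc := (Real.cosh (criticalBeta 3) - Real.sinh (criticalBeta 3) * (G0 / G1)) *
    (Real.cosh (criticalBeta 3) - Real.sinh (criticalBeta 3) * (G2 / G1)) with hpc
  set cc := (Real.cosh (criticalBeta 3) - Real.sinh (criticalBeta 3) * (G1 / G2)) *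
    (Real.cosh (criticalBeta 3) - Real.sinh (criticalBeta 3) * (G1 / G0)) with hcc
  calc G1 ^ 2 * Ap + G2 * G0 * Ac
      ≤ G1 ^ 2 * pc + G2 * G0 * cc :=
        add_le_add (mul_le_mul_of_nonneg_left hpar hG1sq.le) (mul_le_mul_of_nonneg_left hcross hP)
    _ = (pc + G2 * G0 / G1 ^ 2 * cc) * G1 ^ 2 := by
        have h : G1 ^ 2 ≠ 0 := hG1sq.ne'
        field_simp
    _ ≤ (2 * Real.exp (-2 * criticalBeta 3) + ε) * G1 ^ 2 := mul_le_mul_of_nonneg_right hk hG1sq.le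


end Summit.CriticalPhenomena.Ising3DConformalLimit.EnergyNotSigmaSquaredEnergyGapSoft

end
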